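import Mathlib.LinearAlgebra.Matrix.Charpoly.Coeff
import Mathlib.Topology.Algebra.Algebra
import Literature.NumberTheory.GaloisRepresentations.FramedRepEquivConj
import HarnessLib

/-!
# Framed representations: change of coefficients, change of frame, duality (proofs only)

Topic `Literature/NumberTheory/GaloisRepresentations`; a theorems-only companion of
`ContinuousRep.lean` / `GaloisRep.lean` / `FramedRepEquivConj.lean`, written for the definition
request `defn-framedTateGaloisRep` (the framed `GL₂(ℚ̄_ℓ)`-valued Tate module of an elliptic curve,
`EllipticCurves/FramedTateGaloisRep.lean`), where a `ℚ_ℓ`-linear Galois representation is framed in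
a basis (`ContinuousRep.frame`) and pushed to `ℚ̄_ℓ`-coefficients (`FramedRep.baseChange`).  The
Galois predicates of `GaloisRep.lean` must then be transported along both operations:

* change of coefficients `ρ ↦ ρ ⊗_f B` (`FramedRep.baseChange f hf`), `f` injective:
  `FramedRep.baseChange_apply_eq_one_iff`, `FramedRep.charpoly_baseChange`
  (Mathlib `Matrix.charpoly_map`), `FramedRep.baseChange_conj`,
  `FramedGaloisRep.isUnramifiedAt_baseChange_iff`, `FramedGaloisRep.hasFrobCharpolyAt_baseChange`,
  `FramedGaloisRep.hasFrobCharpolyAt_baseChange_iff`;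
* change of frame `ρ ↦ [ρ]_b` (`ContinuousRep.frame b`): `ContinuousRep.frame_apply_eq_one_iff`,
  `ContinuousRep.charpoly_frame` (Mathlib `LinearMap.charpoly_toMatrix`),
  `ContinuousRep.exists_frame_eq_conj` and `ContinuousRep.exists_conj_baseChange_frame` (two bases
  give conjugate frames: `FramedRep.exists_eq_conj_of_equiv` of `FramedRepEquivConj` applied to
  `ContinuousRep.frameEquiv`), `GaloisRep.isUnramifiedAt_frame_iff`,
  `GaloisRep.hasFrobCharpolyAt_frame_iff`;
* duality `ρ ↦ ρ^∨ = (ρᵀ)⁻¹` (`FramedRep.dual`): `FramedRep.charpoly_dual`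
  (`charpoly ρ^∨(g) = charpoly ρ(g⁻¹)`: arithmetic versus geometric Frobenius),
  `FramedGaloisRep.isUnramifiedAt_dual_iff` (the one-sided form is
  `FramedGaloisRep.isUnramifiedAt_dual` of `FramedRepDualProofs`), and in rank `2` over a field
  `FramedGaloisRep.hasFrobCharpolyAt_dual_fin_two` (`X² - aX + d ↦ X² - (a/d)X + d⁻¹`, from the
  elementary `charpoly_inv_of_charpoly_eq_fin_two`);
* `continuous_algebraMap_padicAlgCl`: `ℚ_ℓ → ℚ̄_ℓ = PadicAlgCl ℓ` is continuous (Mathlib's normed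
  algebra structure), the change of coefficients used downstream.

Everything here is folklore linear algebra; no definitions, no named facts.

## References

* J.-P. Serre, *Abelian ℓ-adic representations and elliptic curves* (1968), Ch. I §1.1 (ℓ-adic
  representations, choice of basis), §2.1 (unramified), §2.3 (`P_{v,ρ}` depends only on the
  isomorphism class). [SerreAbelianLadic1968]
* J.-P. Serre, *Linear representations of finite groups* (1977), §1.4 (contragredient).
-/

noncomputable section

open scoped NumberField MatrixGroups Matrix
open Field IsDedekindDomain Polynomial

universe u

namespace Literature.NumberTheory.GaloisRepresentations

/-! ### Change of coefficients -/

section BaseChange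

variable {G : Type*} [Group G] [TopologicalSpace G] {A : Type*} [CommRing A] [TopologicalSpace A]
  {B : Type*} [CommRing B] [TopologicalSpace B] {n : ℕ}

/-- The matrix of `ρ ⊗_f B` at `g` is the entrywise image of the matrix of `ρ` at `g`
(Mathlib `Matrix.GeneralLinearGroup.map`). [folklore] -/
theorem FramedRep.coe_baseChange_apply (f : A →+* B) (hf : Continuous f) (ρ : FramedRep G A n)
    (g : G) :
    ((FramedRep.baseChange f hf ρ g : GL (Fin n) B) : Matrix (Fin n) (Fin n) B) =
      ((ρ g : GL (Fin n) A) : Matrix (Fin n) (Fin n) A).map f :=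
  rfl

/-- Along an injective change of coefficients, `(ρ ⊗_f B)(g) = 1 ↔ ρ(g) = 1`. [folklore] -/
theorem FramedRep.baseChange_apply_eq_one_iff (f : A →+* B) (hf : Continuous f)
    (hinj : Function.Injective f) (ρ : FramedRep G A n) (g : G) :
    FramedRep.baseChange f hf ρ g = 1 ↔ ρ g = 1 := by
  rw [← Units.val_eq_one, FramedRep.coe_baseChange_apply, ← Units.val_eq_one,
    ← (Matrix.map_injective hinj).eq_iff, Matrix.map_one f (map_zero f) (map_one f)]

/-- The characteristic polynomial commutes with change of coefficients
(Mathlib `Matrix.charpoly_map`).  Ref: Serre (1968), Ch. I §2.3. [folklore] -/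
theorem FramedRep.charpoly_baseChange (f : A →+* B) (hf : Continuous f) (ρ : FramedRep G A n)
    (g : G) :
    FramedRep.charpoly (FramedRep.baseChange f hf ρ) g = (FramedRep.charpoly ρ g).map f := by
  unfold FramedRep.charpoly
  rw [FramedRep.coe_baseChange_apply, Matrix.charpoly_map]

/-- Change of coefficients commutes with change of frame:
`(P ρ P⁻¹) ⊗_f B = f(P) (ρ ⊗_f B) f(P)⁻¹`. [folklore] -/
theorem FramedRep.baseChange_conj [IsTopologicalRing A] [IsTopologicalRing B] (f : A →+* B)
    (hf : Continuous f) (P : GL (Fin n) A) (ρ : FramedRep G A n) :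
    FramedRep.baseChange f hf (FramedRep.conj P ρ) =
      FramedRep.conj (Matrix.GeneralLinearGroup.map f P) (FramedRep.baseChange f hf ρ) := by
  refine ContinuousMonoidHom.ext fun g => ?_
  simp only [FramedRep.baseChange_apply, FramedRep.conj_apply, map_mul, map_inv]

/-- **Frobenius on the dual.**  The characteristic polynomial of `ρ^∨(g) = (ρ(g)ᵀ)⁻¹` is that of
`ρ(g⁻¹)` (transpose-invariance, Mathlib `Matrix.charpoly_transpose`): on the dual an *arithmetic*
Frobenius has the characteristic polynomial of the *geometric* Frobenius on `ρ`.
Ref: Serre, *Linear representations of finite groups*, §1.4 (contragredient). [folklore] -/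
theorem FramedRep.charpoly_dual (ρ : FramedRep G A n) (g : G) :
    FramedRep.charpoly (FramedRep.dual ρ) g = FramedRep.charpoly ρ g⁻¹ := by
  unfold FramedRep.charpoly
  rw [FramedRep.coe_dual_apply, Matrix.charpoly_transpose, map_inv]

/-- In rank `2` over a field: if `M` has characteristic polynomial `X² - aX + d` then `M⁻¹` has
characteristic polynomial `X² - (a/d) X + d⁻¹` (for invertible `M`, `d = det M ≠ 0`:
`tr M⁻¹ = tr M / det M`, `det M⁻¹ = (det M)⁻¹`; for singular `M` both sides are computed with
Mathlib's junk values `M⁻¹ = 0`, `0⁻¹ = 0` and still agree).  Mathlib `Matrix.charpoly_fin_two`,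
`Matrix.inv_def`, `Matrix.adjugate_fin_two`. [folklore] -/
theorem charpoly_inv_of_charpoly_eq_fin_two {F : Type*} [Field F] {M : Matrix (Fin 2) (Fin 2) F}
    {a d : F} (h : M.charpoly = X ^ 2 - C a * X + C d) :
    M⁻¹.charpoly = X ^ 2 - C (a / d) * X + C d⁻¹ := by
  rw [Matrix.charpoly_fin_two] at h
  have hdet : M.det = d := by
    have h0 := congrArg (fun p : F[X] => p.coeff 0) h
    simpa using h0
  have htr : M.trace = a := by
    have h1 := congrArg (fun p : F[X] => p.coeff 1) h
    simpa using h1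
  have htr' : M⁻¹.trace = a / d := by
    rw [Matrix.inv_def, Matrix.trace_smul, Matrix.adjugate_fin_two, Matrix.trace_fin_two,
      Ring.inverse_eq_inv', hdet, smul_eq_mul]
    simp only [Matrix.of_apply, Matrix.cons_val', Matrix.cons_val_zero, Matrix.cons_val_one,
      Matrix.empty_val', Matrix.cons_val_fin_one]
    rw [← htr, Matrix.trace_fin_two]
    ring
  rw [Matrix.charpoly_fin_two, htr', Matrix.det_nonsing_inv, Ring.inverse_eq_inv', hdet]

end BaseChange

/-! ### Galois predicates under change of coefficients and duality -/

section Galois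

variable {K : Type u} [Field K] {A : Type*} [CommRing A] [TopologicalSpace A]
  {B : Type*} [CommRing B] [TopologicalSpace B] {n : ℕ}

/-- Unramifiedness at `v` is unchanged by an injective change of coefficients.
Ref: Serre (1968), Ch. I §2.1. [folklore] -/
theorem FramedGaloisRep.isUnramifiedAt_baseChange_iff (f : A →+* B) (hf : Continuous f)
    (hinj : Function.Injective f) (v : HeightOneSpectrum (𝓞 K)) (ρ : FramedGaloisRep K A n) :
    FramedGaloisRep.IsUnramifiedAt v (FramedRep.baseChange f hf ρ) ↔ ρ.IsUnramifiedAt v :=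
  forall₂_congr fun _ _ => forall₂_congr fun σ _ =>
    FramedRep.baseChange_apply_eq_one_iff f hf hinj ρ σ

/-- Frobenius characteristic polynomials are transported by a change of coefficients: `P` on `ρ`
gives `f(P)` on `ρ ⊗_f B`.  Ref: Serre (1968), Ch. I §2.3. [folklore] -/
theorem FramedGaloisRep.hasFrobCharpolyAt_baseChange (f : A →+* B) (hf : Continuous f)
    {v : HeightOneSpectrum (𝓞 K)} {ρ : FramedGaloisRep K A n} {P : A[X]}
    (h : ρ.HasFrobCharpolyAt v P) :
    FramedGaloisRep.HasFrobCharpolyAt v (P.map f) (FramedRep.baseChange f hf ρ) :=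
  fun 𝔓 h𝔓 σ hσ => by rw [FramedRep.charpoly_baseChange, h 𝔓 h𝔓 σ hσ]

/-- For an injective change of coefficients, `ρ ⊗_f B` has Frobenius characteristic polynomial
`f(P)` at `v` iff `ρ` has Frobenius characteristic polynomial `P` at `v`.
Ref: Serre (1968), Ch. I §2.3. [folklore] -/
theorem FramedGaloisRep.hasFrobCharpolyAt_baseChange_iff (f : A →+* B) (hf : Continuous f)
    (hinj : Function.Injective f) (v : HeightOneSpectrum (𝓞 K)) (ρ : FramedGaloisRep K A n)
    (P : A[X]) :
    FramedGaloisRep.HasFrobCharpolyAt v (P.map f) (FramedRep.baseChange f hf ρ) ↔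
      ρ.HasFrobCharpolyAt v P := by
  refine forall₂_congr fun 𝔓 _ => forall₂_congr fun σ _ => ?_
  rw [FramedRep.charpoly_baseChange, (Polynomial.map_injective f hinj).eq_iff]

/-- The dual `ρ^∨` is unramified at `v` iff `ρ` is (the one-sided form is
`FramedGaloisRep.isUnramifiedAt_dual` of `FramedRepDualProofs`).
Ref: Serre (1968), Ch. I §2.1. [folklore] -/
theorem FramedGaloisRep.isUnramifiedAt_dual_iff (v : HeightOneSpectrum (𝓞 K))
    (ρ : FramedGaloisRep K A n) :
    FramedGaloisRep.IsUnramifiedAt v (FramedRep.dual ρ) ↔ ρ.IsUnramifiedAt v := by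
  refine forall₂_congr fun 𝔓 _ => forall₂_congr fun σ _ => ?_
  change glTransposeInv (Fin n) A (ρ σ) = 1 ↔ ρ σ = 1
  constructor
  · intro h
    have h1 : (((ρ σ)⁻¹ : GL (Fin n) A) : Matrix (Fin n) (Fin n) A)ᵀ = 1 := by
      rw [← coe_glTransposeInv_apply, h, Units.val_one]
    have h2 : ((ρ σ)⁻¹ : GL (Fin n) A) = 1 := by
      apply Units.ext
      rw [Units.val_one, ← Matrix.transpose_one, ← h1, Matrix.transpose_transpose]
    exact inv_eq_one.1 h2
  · intro h
    rw [h, map_one]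

/-- **Frobenius on the dual in rank `2`** (field coefficients): if every arithmetic Frobenius at
`v` has characteristic polynomial `X² - aX + d` on `ρ`, then it has characteristic polynomial
`X² - (a/d) X + d⁻¹` on `ρ^∨` (`d = det ρ(Frob)` is then a unit).  For the Tate module of an
elliptic curve (`a = a_v`, `d = q_v`) this is the passage between the arithmetic Frobenius on
`V_ℓ E` and on `H¹_ét(E_{K̄}, ℚ_ℓ) = V_ℓ(E)^∨`.  Ref: Serre (1968), Ch. I §2.3. [folklore] -/
theorem FramedGaloisRep.hasFrobCharpolyAt_dual_fin_two {F : Type*} [Field F] [TopologicalSpace F]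
    {v : HeightOneSpectrum (𝓞 K)} {ρ : FramedGaloisRep K F 2} {a d : F}
    (h : ρ.HasFrobCharpolyAt v (X ^ 2 - C a * X + C d)) :
    FramedGaloisRep.HasFrobCharpolyAt v (X ^ 2 - C (a / d) * X + C d⁻¹) (FramedRep.dual ρ) := by
  intro 𝔓 h𝔓 σ hσ
  rw [FramedRep.charpoly_dual]
  unfold FramedRep.charpoly
  rw [map_inv, Matrix.coe_units_inv]
  exact charpoly_inv_of_charpoly_eq_fin_two (h 𝔓 h𝔓 σ hσ)

end Galois

/-! ### Change of frame -/

section Frame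

variable {K : Type u} [Field K] {A : Type*} [CommRing A] [TopologicalSpace A] [IsTopologicalRing A]
  {M : Type*} [AddCommGroup M] [Module A M] [TopologicalSpace M] [IsModuleTopology A M] {n : ℕ}
  {G : Type*} [Group G] [TopologicalSpace G] [ContinuousInv G]

/-- In a frame, `[ρ(g)]_b = 1 ↔ ρ(g) = 1`. [folklore] -/
theorem ContinuousRep.frame_apply_eq_one_iff (ρ : ContinuousRep G A M)
    (b : Module.Basis (Fin n) A M) (g : G) : ρ.frame b g = 1 ↔ ρ g = 1 := by
  rw [← Units.val_eq_one, ContinuousRep.coe_frame_apply, ← LinearMap.toMatrix_one b,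
    (LinearMap.toMatrix b b).injective.eq_iff]

/-- The characteristic polynomial in a frame is that of the linear map
(Mathlib `LinearMap.charpoly_toMatrix`). [folklore] -/
theorem ContinuousRep.charpoly_frame [Module.Free A M] [Module.Finite A M]
    (ρ : ContinuousRep G A M) (b : Module.Basis (Fin n) A M) (g : G) :
    FramedRep.charpoly (ρ.frame b) g = (ρ g).charpoly := by
  unfold FramedRep.charpoly
  rw [ContinuousRep.coe_frame_apply, LinearMap.charpoly_toMatrix]

/-- **Two frames of one representation are conjugate**: for bases `b, b'` of `M` there is
`P ∈ GL_n(A)` with `[ρ]_{b'} = P [ρ]_b P⁻¹` (`FramedRep.exists_eq_conj_of_equiv` applied to the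
equivalences `ContinuousRep.frameEquiv`).  Ref: Serre (1968), Ch. I §1.1. [folklore] -/
theorem ContinuousRep.exists_frame_eq_conj (ρ : ContinuousRep G A M)
    (b b' : Module.Basis (Fin n) A M) :
    ∃ P : GL (Fin n) A, ρ.frame b' = FramedRep.conj P (ρ.frame b) :=
  FramedRep.exists_eq_conj_of_equiv (ρ.frame b) (ρ.frame b')
    ((ρ.frameEquiv b).trans (ρ.frameEquiv b').symm)

/-- Two frames of one representation stay conjugate after any change of coefficients
(`exists_frame_eq_conj` with `FramedRep.baseChange_conj`).  Ref: Serre (1968), Ch. I §1.1.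
[folklore] -/
theorem ContinuousRep.exists_conj_baseChange_frame {B : Type*} [CommRing B] [TopologicalSpace B]
    [IsTopologicalRing B] (f : A →+* B) (hf : Continuous f) (ρ : ContinuousRep G A M)
    (b b' : Module.Basis (Fin n) A M) :
    ∃ P : GL (Fin n) B, FramedRep.conj P (FramedRep.baseChange f hf (ρ.frame b)) =
      FramedRep.baseChange f hf (ρ.frame b') := by
  obtain ⟨P, hP⟩ := ρ.exists_frame_eq_conj b b'
  exact ⟨Matrix.GeneralLinearGroup.map f P, by rw [hP, FramedRep.baseChange_conj]⟩

/-- Unramifiedness at `v` is read off in any frame.  Ref: Serre (1968), Ch. I §2.1. [folklore] -/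
theorem GaloisRep.isUnramifiedAt_frame_iff (v : HeightOneSpectrum (𝓞 K)) (ρ : GaloisRep K A M)
    (b : Module.Basis (Fin n) A M) :
    FramedGaloisRep.IsUnramifiedAt v (ρ.frame b) ↔ ρ.IsUnramifiedAt v :=
  forall₂_congr fun _ _ => forall₂_congr fun σ _ => ρ.frame_apply_eq_one_iff b σ

/-- Frobenius characteristic polynomials are read off in any frame.
Ref: Serre (1968), Ch. I §2.3. [folklore] -/
theorem GaloisRep.hasFrobCharpolyAt_frame_iff [Module.Free A M] [Module.Finite A M]
    (v : HeightOneSpectrum (𝓞 K)) (ρ : GaloisRep K A M) (b : Module.Basis (Fin n) A M)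
    (P : A[X]) :
    FramedGaloisRep.HasFrobCharpolyAt v P (ρ.frame b) ↔ ρ.HasFrobCharpolyAt v P := by
  refine forall₂_congr fun 𝔓 _ => forall₂_congr fun σ _ => ?_
  rw [ρ.charpoly_frame b σ]

end Frame

/-! ### Coefficients `ℚ̄_ℓ` -/

/-- The inclusion `ℚ_ℓ → ℚ̄_ℓ = PadicAlgCl ℓ` is continuous (`PadicAlgCl ℓ` is a normed
`ℚ_ℓ`-algebra, Mathlib `PadicAlgCl.normedAlgebra`); it is also injective (a field map), so all of
the above applies to `FramedRep.baseChange (algebraMap ℚ_[ℓ] (PadicAlgCl ℓ))`. [folklore] -/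
theorem continuous_algebraMap_padicAlgCl (ℓ : ℕ) [Fact ℓ.Prime] :
    Continuous (algebraMap ℚ_[ℓ] (PadicAlgCl ℓ)) :=
  continuous_algebraMap ℚ_[ℓ] (PadicAlgCl ℓ)

end Literature.NumberTheory.GaloisRepresentations
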